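import Mathlib
import HarnessLib

/-!
# ValiantsHypothesis / LacunarySymmetroid — crux `MatrixDescartes` (stmt-ValiantsHypothesis-18050, V1),
# LINE (A) «product_plus_one», floor `OneChangeFloorK3`: the PUSH / DRAG LOG-CONCAVITY IDENTITY (algebraic core, every ratio)

Capacity currency of the `K = 3` rows (✓ `…ProductPlusOneMidSwitching`, ✓ `…SingleEpisode`, ✓ `…ActivityThreshold`; `θ = x·d/dx`):
for a row `g = a + b x^p + c x^q` with `bc > 0` (incoherent no-dip OR one-signed) put `φ = θg/g`, `N = |θg| = p|b|x^p + q|c|x^q`,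
`K = θN/N`, `μ = K − p ∈ (0, q−p)`, `κ = θK = μ(q−p−μ)` (✓ `sepWeight_pull_theta_identities`), `δ = μ − φ`, and the bottom-weight term
`ψ = x^{−p}φ` (`= Ψ_j/p` of the lane).  Then (logistic Riccati law and its consequences, all one-line quotient rules)

  `θφ = φ(K − φ) = φ(p + δ)`,  `θ log|ψ| = δ`,  `θδ = κ − φ(p+δ)`,  `θκ = κ(q−p−2μ)`,  `θ²δ = θκ − φ(p+δ)² − φ·θδ`,

so `θψ = ψδ` (a switched incoherent row PUSHES UP iff `δ > 0`; a puller has `ψ < 0 < δ`) and, wherever `ψδ ≠ 0`,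
`θ² log|θψ| = θδ + (δ·θ²δ − (θδ)²)/δ² = T/δ²` with `T = θδ·δ² + θ²δ·δ − (θδ)²`.  THIS FILE proves the closed form

  ★ `pushLogConcavity_identity`:   `T = −φ·(2δ³ + 2p·δ² + p·μ·δ + μ·(q − 2p − μ)²)`   (pure algebra, `ring`),

and its signs (`pushBracket_pos`: the bracket is `> 0` for `δ > 0`, `μ ≥ 0`, `p > 0`):
* ★★ `push_logConcave_core` — ACTIVE RISER / ONE-SIGNED ROW (`φ > 0`, `δ > 0`): `T < 0`, i.e. the push `θψ > 0` is STRICTLY LOG-CONCAVE in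
  `u = log x` along every pushing episode (located first numerically: 0 violations on 5 210 episode triples, NOTE rev 2 §6);
* ★★ `drag_logConvex_core` — PULLER (`φ < 0`, hence `δ = μ + |φ| > 0`): `T > 0`, i.e. the drag `|θψ|` of an unswitched incoherent row is STRICTLY
  LOG-CONVEX in `u` (extends ✓ `…PullConvex`, which is the same statement for `|φ|` without the weight and the factor `μ + |φ|`).

CONSEQUENCE (paper, the calculus wiring being routine and the counting being ✓ `…SingleEpisode`'s sup/inf pattern): on a segment of a gap where ONE
row is active and every other row is a puller, `Ψ′ = P − Q` with `P` log-concave and `Q` (a sum of log-convex drags) log-convex, so `{Ψ′ ≥ 0}` is an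
interval, `Ψ` has at most one local minimum there and `eulerNumerator d a 0` at most `3` zeros — the FIRST GAP of every pure incoherent company at
EVERY ratio (generalising ✓ `oneRiser_eulerNumerator_no_four_zeros`, binomial clouds, to trinomial pullers in any phase of their walls).
The inactive switched rows (`φ > 0 > δ`) are the only terms with no sign here (their drag is log-concave where the bracket is positive).

HONEST FRAMING: algebraic core of a row law; closes NO stub; NOT `OneChangeFloorK3` / `stub_eulerBoundK3` / `stub_classRowK3` / `stub_polyLaw` /
`MatrixDescartes`; `VP ≠ VNP` is NOT proved.  No definitions, no named facts, no sorry; Mathlib only.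

[folklore] Polynomial identity; no citation needed.
-/

set_option linter.dupNamespace false

namespace Summit.ValiantsHypothesis.ValiantsHypothesis.Theorems.LacunarySymmetroidMatrixDescartes

namespace ProductPlusOne

/-- ★ **PUSH / DRAG LOG-CONCAVITY IDENTITY** (pure algebra).  With `δ = μ − φ`, `κ = μ(q−p−μ)`, `θκ = κ(q−p−2μ)`,
`θδ = κ − φ(p+δ)`, `θ²δ = θκ − φ(p+δ)² − φ·θδ` (the values forced by the logistic Riccati law), the log-concavity numerator
`T = θδ·δ² + θ²δ·δ − (θδ)²` equals `−φ·(2δ³ + 2pδ² + pμδ + μ(q−2p−μ)²)`. [folklore] -/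
theorem pushLogConcavity_identity (φ μ p q : ℝ) :
    let δ := μ - φ
    let κ := μ * (q - p - μ)
    let dκ := κ * (q - p - 2 * μ)
    let dδ := κ - φ * (p + δ)
    let ddδ := dκ - φ * (p + δ) ^ 2 - φ * dδ
    dδ * δ ^ 2 + ddδ * δ - dδ ^ 2
      = -(φ * (2 * δ ^ 3 + 2 * p * δ ^ 2 + p * μ * δ + μ * (q - 2 * p - μ) ^ 2)) := by
  intro δ κ dκ dδ ddδ
  simp only [δ, κ, dκ, dδ, ddδ]
  ring

/-- The bracket `2δ³ + 2pδ² + pμδ + μ(q−2p−μ)²` is positive for `δ > 0`, `μ ≥ 0`, `p > 0`. [folklore] -/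
theorem pushBracket_pos {δ μ p : ℝ} (q : ℝ) (hδ : 0 < δ) (hμ : 0 ≤ μ) (hp : 0 < p) :
    0 < 2 * δ ^ 3 + 2 * p * δ ^ 2 + p * μ * δ + μ * (q - 2 * p - μ) ^ 2 := by
  have h1 : 0 < 2 * δ ^ 3 := by positivity
  have h2 : 0 < 2 * p * δ ^ 2 := by positivity
  have h3 : 0 ≤ p * μ * δ := by positivity
  have h4 : 0 ≤ μ * (q - 2 * p - μ) ^ 2 := by positivity
  linarith

/-- ★★ **ACTIVE RISERS AND ONE-SIGNED ROWS PUSH LOG-CONCAVELY** (sign core): for `φ > 0`, `δ = μ − φ > 0` (the row is inside a pushing episode),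
`μ ≥ 0`, `p > 0`, the log-concavity numerator `T` is NEGATIVE. [this file's theorem] -/
theorem push_logConcave_core {φ μ p : ℝ} (q : ℝ) (hφ : 0 < φ) (hδ : 0 < μ - φ) (hμ : 0 ≤ μ) (hp : 0 < p) :
    let δ := μ - φ
    let κ := μ * (q - p - μ)
    let dκ := κ * (q - p - 2 * μ)
    let dδ := κ - φ * (p + δ)
    let ddδ := dκ - φ * (p + δ) ^ 2 - φ * dδ
    dδ * δ ^ 2 + ddδ * δ - dδ ^ 2 < 0 := by
  have hid := pushLogConcavity_identity φ μ p q
  simp only at hid ⊢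
  rw [hid, neg_lt_zero]
  exact mul_pos hφ (pushBracket_pos q hδ hμ hp)

/-- ★★ **PULLERS DRAG LOG-CONVEXLY** (sign core): for `φ < 0` (unswitched incoherent row: `θg/g < 0`), `μ ≥ 0`, `p > 0` — so that
`δ = μ − φ = μ + |φ| > 0` automatically — the numerator `T` is POSITIVE: the drag `|θψ|` is strictly log-convex in `u = log x`. [this file's theorem] -/
theorem drag_logConvex_core {φ μ p : ℝ} (q : ℝ) (hφ : φ < 0) (hμ : 0 ≤ μ) (hp : 0 < p) :
    let δ := μ - φ
    let κ := μ * (q - p - μ)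
    let dκ := κ * (q - p - 2 * μ)
    let dδ := κ - φ * (p + δ)
    let ddδ := dκ - φ * (p + δ) ^ 2 - φ * dδ
    0 < dδ * δ ^ 2 + ddδ * δ - dδ ^ 2 := by
  have hid := pushLogConcavity_identity φ μ p q
  simp only at hid ⊢
  rw [hid, neg_pos]
  exact mul_neg_of_neg_of_pos hφ (pushBracket_pos q (by linarith) hμ hp)

/-- **Boundary values** (consistency checks of the identity): at `δ = 0` (`φ = μ`, the edge of an episode) `T = −(θδ)² = −μ²(q−2p−μ)²`, and at
`φ = 0` (a pole-free one-signed limit) `T = 0`. [folklore] -/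
theorem pushLogConcavity_boundary (μ p q : ℝ) :
    (let φ := μ
     let δ := μ - φ
     let κ := μ * (q - p - μ)
     let dκ := κ * (q - p - 2 * μ)
     let dδ := κ - φ * (p + δ)
     let ddδ := dκ - φ * (p + δ) ^ 2 - φ * dδ
     dδ * δ ^ 2 + ddδ * δ - dδ ^ 2 = -(μ ^ 2 * (q - 2 * p - μ) ^ 2)) ∧
    (let φ := (0 : ℝ)
     let δ := μ - φ
     let κ := μ * (q - p - μ)
     let dκ := κ * (q - p - 2 * μ)
     let dδ := κ - φ * (p + δ)
     let ddδ := dκ - φ * (p + δ) ^ 2 - φ * dδ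
     dδ * δ ^ 2 + ddδ * δ - dδ ^ 2 = 0) := by
  constructor
  · simp only
    ring
  · simp only
    ring

end ProductPlusOne

end Summit.ValiantsHypothesis.ValiantsHypothesis.Theorems.LacunarySymmetroidMatrixDescartes
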